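import Summits.CriticalPhenomena.PercolationContinuityZ3.Theorems.PercNearOneGluingNoHeavyLowerTailSahiE4UnionHoldMoments
import Summits.CriticalPhenomena.PercolationContinuityZ3.Theorems.PercNearOneGluingNoHeavyLowerTailSahiE4UnionAtoms
import Summits.CriticalPhenomena.PercolationContinuityZ3.Theorems.PercNearOneGluingNoHeavyLowerTailSahiE4UnionTensorMoments
import Summits.CriticalPhenomena.PercolationContinuityZ3.Theorems.PercNearOneGluingNoHeavyLowerTailSahiE4UnionChainBlock
import Mathlib.Tactic.LinearCombination
import HarnessLib

/-!
# `NoHeavyLowerTail` (crux stmt-CriticalPhenomena-4575), Sahi programme P4, ORDER 4: `E₄ ≥ 0` is preserved when an independent CHAIN block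
# (three nested `{0,1}`-events, equivalently a random level) is OR-ed into three of four members — measure level

Support file (cell `prim-l12`, seat P4, generation 35; `--supports stmt-CriticalPhenomena-4575`).  No definitions, no named facts, no sorries;
standard axioms.  Measure-level form of the certificate core `SahiE4UnionChainBlock.e4_orChain_nonneg_of_holdMoments` (its module docstring
has the context: the three-member step `O4[K={0,1,2}]` is affine in the joint moments of the block, its minimum over the `b`-row polytope sits at
vertices, and the chain is the first vertex family; as a cubic form in the pattern atoms of `b` the functional is Bernstein-positive exactly on
chain monomials).

SETTING. `(γ,μ)`, `(β,ν)` finite probability weights; `a : Fin 4 → γ → [0,1]`; `b : Fin 4 → β → [0,1]` with `b_3 = 0` and the block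
MULTIPLICATIVELY NESTED: `b_0b_1 = b_1`, `b_0b_2 = b_2`, `b_1b_2 = b_2` pointwise (for indicators: `B_2 ⊆ B_1 ⊆ B_0`; no positivity, monotonicity
or FKG hypothesis on the block is needed — a chain carries none).  Member-wise OR family `u_i(x,y) = a_i(x) + b_i(y) − a_i(x)b_i(y)`
(`= (a_0 ∨ b_0, a_1 ∨ b_1, a_2 ∨ b_2, a_3)` for events).  If the `a`-side satisfies the Harris rows `Cov(a_2,a_3)`, `Cov(a_2,a_1a_3)`,
`Cov(a_2,a_0a_1a_3)`, `Cov(a_3,a_1a_2)`, `Cov(a_3,a_0a_1a_2) ≥ 0`, Sahi's `E₃(a_1,a_2,a_3) ≥ 0` [Sahi2008, eq. (7); LiebSahi2021, Def. 3.1], the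
order-3 PRODUCT rows `E₃(a_0a_1,a_2,a_3)`, `E₃(a_0a_2,a_1,a_3)`, `E₃(a_1a_2,a_0,a_3)`, `E₃(a_0a_3,a_1,a_2) ≥ 0` and `E₄(a) ≥ 0`, then `E₄^{μ⊗ν}(u) ≥ 0`.
On an FKG lattice with monotone `a` all hypotheses are instances of Sahi positivity of orders 2, 3, 4 of `μ`.  Proof: the fifteen joint
moments of `u` (`SahiE4UnionHold.uMoment_S`), inclusion–exclusion (`exFail_S`), `b_3 = 0`, the nesting identities, and the core.
Relation to the tree: generalises `SahiMixture.orThreeOfFourCell_holds` (one coin into three members; cell `prim-masterthm` P3) from a coin to an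
arbitrary totally ordered block.  HONEST FRAMING: one vertex family of the three-member step; conjecture O4[K=012] (arbitrary positively
associated block) is open. [this work]
-/

noncomputable section

namespace Summit.CriticalPhenomena.PercolationContinuityZ3.Theorems.SahiE4UnionChainBlock

open Finset Function Literature.Combinatorics.Sahi2008
open Summit.CriticalPhenomena.PercolationContinuityZ3.Theorems.SahiE3UnionTensor (ex_add' ex_sub' sum_prodWeight ex_tensor)
open Summit.CriticalPhenomena.PercolationContinuityZ3.Theorems.SahiE4UnionTensor (sahiE_four_apply)
open Summit.CriticalPhenomena.PercolationContinuityZ3.Theorems.SahiE4UnionHold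


variable {γ β : Type*} [Fintype γ] [Fintype β]

/-- **Order-4 OR step, CHAIN block into three members, measure level.**  See the module docstring. [this work] -/
theorem sahiE_four_orChain_nonneg (μ : γ → ℝ) (ν : β → ℝ)
    (hμ0 : ∀ t, 0 ≤ μ t) (hμ1 : ∑ t, μ t = 1) (hν0 : ∀ t, 0 ≤ ν t) (hν1 : ∑ t, ν t = 1)
    (a : Fin 4 → γ → ℝ) (b : Fin 4 → β → ℝ) (ha0 : ∀ i t, 0 ≤ a i t) (ha1 : ∀ i t, a i t ≤ 1) (hb0 : ∀ i t, 0 ≤ b i t) (hb1 : ∀ i t, b i t ≤ 1)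
    (hbz3 : ∀ t, b 3 t = 0)
    (hb01 : ∀ t, b 0 t * b 1 t = b 1 t) (hb02 : ∀ t, b 0 t * b 2 t = b 2 t) (hb12 : ∀ t, b 1 t * b 2 t = b 2 t)
    (ha_cf_2_3 : 0 ≤ ex μ (a 2 * a 3) - ex μ (a 2)*ex μ (a 3))
    (ha_ch_2_13 : 0 ≤ ex μ (a 1 * a 2 * a 3) - ex μ (a 1 * a 3)*ex μ (a 2))
    (ha_ch_2_013 : 0 ≤ ex μ (a 0 * a 1 * a 2 * a 3) - ex μ (a 0 * a 1 * a 3)*ex μ (a 2))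
    (ha_ch_12_3 : 0 ≤ ex μ (a 1 * a 2 * a 3) - ex μ (a 1 * a 2)*ex μ (a 3))
    (ha_ch_012_3 : 0 ≤ ex μ (a 0 * a 1 * a 2 * a 3) - ex μ (a 0 * a 1 * a 2)*ex μ (a 3))
    (hha_e3h_123 : 0 ≤ sahiE μ 3 ![a 1, a 2, a 3])
    (hha_e4h : 0 ≤ sahiE μ 4 a)
    (hha_p3h_01 : 0 ≤ sahiE μ 3 ![a 0 * a 1, a 2, a 3])
    (hha_p3h_02 : 0 ≤ sahiE μ 3 ![a 0 * a 2, a 1, a 3])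
    (hha_p3h_12 : 0 ≤ sahiE μ 3 ![a 1 * a 2, a 0, a 3])
    (hha_p3h_03 : 0 ≤ sahiE μ 3 ![a 0 * a 3, a 1, a 2])
    : 0 ≤ sahiE (fun p : γ × β => μ p.1 * ν p.2) 4 (fun (i : Fin 4) (p : γ × β) => a i p.1 + b i p.2 - a i p.1 * b i p.2) := by
  have zb3 : ex ν (b 3) = 0 := by
    rw [show b 3 = fun _ => (0:ℝ) from funext fun t => by simp [hbz3]]; exact ex_const hν1 0
  have zb03 : ex ν (b 0 * b 3) = 0 := by
    rw [show b 0 * b 3 = fun _ => (0:ℝ) from funext fun t => by simp [Pi.mul_apply, hbz3]]; exact ex_const hν1 0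
  have zb13 : ex ν (b 1 * b 3) = 0 := by
    rw [show b 1 * b 3 = fun _ => (0:ℝ) from funext fun t => by simp [Pi.mul_apply, hbz3]]; exact ex_const hν1 0
  have zb23 : ex ν (b 2 * b 3) = 0 := by
    rw [show b 2 * b 3 = fun _ => (0:ℝ) from funext fun t => by simp [Pi.mul_apply, hbz3]]; exact ex_const hν1 0
  have zb013 : ex ν (b 0 * b 1 * b 3) = 0 := by
    rw [show b 0 * b 1 * b 3 = fun _ => (0:ℝ) from funext fun t => by simp [Pi.mul_apply, hbz3]]; exact ex_const hν1 0
  have zb023 : ex ν (b 0 * b 2 * b 3) = 0 := by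
    rw [show b 0 * b 2 * b 3 = fun _ => (0:ℝ) from funext fun t => by simp [Pi.mul_apply, hbz3]]; exact ex_const hν1 0
  have zb123 : ex ν (b 1 * b 2 * b 3) = 0 := by
    rw [show b 1 * b 2 * b 3 = fun _ => (0:ℝ) from funext fun t => by simp [Pi.mul_apply, hbz3]]; exact ex_const hν1 0
  have zb0123 : ex ν (b 0 * b 1 * b 2 * b 3) = 0 := by
    rw [show b 0 * b 1 * b 2 * b 3 = fun _ => (0:ℝ) from funext fun t => by simp [Pi.mul_apply, hbz3]]; exact ex_const hν1 0
  have hn01 : ex ν (b 0 * b 1) = ex ν (b 1) := by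
    rw [show b 0 * b 1 = b 1 from funext fun t => by simp only [Pi.mul_apply]; exact hb01 t]
  have hn02 : ex ν (b 0 * b 2) = ex ν (b 2) := by
    rw [show b 0 * b 2 = b 2 from funext fun t => by simp only [Pi.mul_apply]; exact hb02 t]
  have hn12 : ex ν (b 1 * b 2) = ex ν (b 2) := by
    rw [show b 1 * b 2 = b 2 from funext fun t => by simp only [Pi.mul_apply]; exact hb12 t]
  have hn012 : ex ν (b 0 * b 1 * b 2) = ex ν (b 2) := by
    rw [show b 0 * b 1 * b 2 = b 2 from funext fun t => by simp only [Pi.mul_apply]; rw [hb01 t, hb12 t]]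
  have ha_at_ : 0 ≤ ex μ (a 0 * a 1 * a 2 * a 3) := exAtom_none_nonneg μ hμ0 a ha0 
  have ha_at_0 : 0 ≤ -ex μ (a 0 * a 1 * a 2 * a 3) + ex μ (a 1 * a 2 * a 3) := exAtom_0_nonneg μ hμ0 a ha0 ha1
  have ha_at_13 : 0 ≤ -ex μ (a 0 * a 1 * a 2) + ex μ (a 0 * a 1 * a 2 * a 3) + ex μ (a 0 * a 2) - ex μ (a 0 * a 2 * a 3) := exAtom_13_nonneg μ hμ0 a ha0 ha1
  have ha_at_013 : 0 ≤ ex μ (a 0 * a 1 * a 2) - ex μ (a 0 * a 1 * a 2 * a 3) - ex μ (a 0 * a 2) + ex μ (a 0 * a 2 * a 3) - ex μ (a 1 * a 2) + ex μ (a 1 * a 2 * a 3) + ex μ (a 2) - ex μ (a 2 * a 3) := exAtom_013_nonneg μ hμ0 a ha0 ha1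
  have ha_at_23 : 0 ≤ ex μ (a 0 * a 1) - ex μ (a 0 * a 1 * a 2) + ex μ (a 0 * a 1 * a 2 * a 3) - ex μ (a 0 * a 1 * a 3) := exAtom_23_nonneg μ hμ0 a ha0 ha1
  have ha_at_023 : 0 ≤ -ex μ (a 0 * a 1) + ex μ (a 0 * a 1 * a 2) - ex μ (a 0 * a 1 * a 2 * a 3) + ex μ (a 0 * a 1 * a 3) + ex μ (a 1) - ex μ (a 1 * a 2) + ex μ (a 1 * a 2 * a 3) - ex μ (a 1 * a 3) := exAtom_023_nonneg μ hμ0 a ha0 ha1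
  have ha_at_123 : 0 ≤ ex μ (a 0) - ex μ (a 0 * a 1) + ex μ (a 0 * a 1 * a 2) - ex μ (a 0 * a 1 * a 2 * a 3) + ex μ (a 0 * a 1 * a 3) - ex μ (a 0 * a 2) + ex μ (a 0 * a 2 * a 3) - ex μ (a 0 * a 3) := exAtom_123_nonneg μ hμ0 a ha0 ha1
  have ha_at_0123 : 0 ≤ 1 - ex μ (a 0) + ex μ (a 0 * a 1) - ex μ (a 0 * a 1 * a 2) + ex μ (a 0 * a 1 * a 2 * a 3) - ex μ (a 0 * a 1 * a 3) + ex μ (a 0 * a 2) - ex μ (a 0 * a 2 * a 3) + ex μ (a 0 * a 3) - ex μ (a 1) + ex μ (a 1 * a 2) - ex μ (a 1 * a 2 * a 3) + ex μ (a 1 * a 3) - ex μ (a 2) + ex μ (a 2 * a 3) - ex μ (a 3) := exAtom_0123_nonneg μ hμ0 hμ1 a ha1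
  have ha_at_1 : 0 ≤ -ex μ (a 0 * a 1 * a 2 * a 3) + ex μ (a 0 * a 2 * a 3) := exAtom_1_nonneg μ hμ0 a ha0 ha1
  have ha_at_01 : 0 ≤ ex μ (a 0 * a 1 * a 2 * a 3) - ex μ (a 0 * a 2 * a 3) - ex μ (a 1 * a 2 * a 3) + ex μ (a 2 * a 3) := exAtom_01_nonneg μ hμ0 a ha0 ha1
  have ha_at_2 : 0 ≤ -ex μ (a 0 * a 1 * a 2 * a 3) + ex μ (a 0 * a 1 * a 3) := exAtom_2_nonneg μ hμ0 a ha0 ha1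
  have ha_at_02 : 0 ≤ ex μ (a 0 * a 1 * a 2 * a 3) - ex μ (a 0 * a 1 * a 3) - ex μ (a 1 * a 2 * a 3) + ex μ (a 1 * a 3) := exAtom_02_nonneg μ hμ0 a ha0 ha1
  have ha_at_12 : 0 ≤ ex μ (a 0 * a 1 * a 2 * a 3) - ex μ (a 0 * a 1 * a 3) - ex μ (a 0 * a 2 * a 3) + ex μ (a 0 * a 3) := exAtom_12_nonneg μ hμ0 a ha0 ha1
  have ha_at_012 : 0 ≤ -ex μ (a 0 * a 1 * a 2 * a 3) + ex μ (a 0 * a 1 * a 3) + ex μ (a 0 * a 2 * a 3) - ex μ (a 0 * a 3) + ex μ (a 1 * a 2 * a 3) - ex μ (a 1 * a 3) - ex μ (a 2 * a 3) + ex μ (a 3) := exAtom_012_nonneg μ hμ0 a ha0 ha1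
  have ha_at_3 : 0 ≤ ex μ (a 0 * a 1 * a 2) - ex μ (a 0 * a 1 * a 2 * a 3) := exAtom_3_nonneg μ hμ0 a ha0 ha1
  have ha_at_03 : 0 ≤ -ex μ (a 0 * a 1 * a 2) + ex μ (a 0 * a 1 * a 2 * a 3) + ex μ (a 1 * a 2) - ex μ (a 1 * a 2 * a 3) := exAtom_03_nonneg μ hμ0 a ha0 ha1
  have ha_ct_0 : 0 ≤ 1 - ex μ (a 0) := by
    have h := ex_mono hμ0 (fun t => ha1 0 t); rw [ex_const hμ1] at h; linarith
  have ha_ct_1 : 0 ≤ 1 - ex μ (a 1) := by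
    have h := ex_mono hμ0 (fun t => ha1 1 t); rw [ex_const hμ1] at h; linarith
  have ha_ct_2 : 0 ≤ 1 - ex μ (a 2) := by
    have h := ex_mono hμ0 (fun t => ha1 2 t); rw [ex_const hμ1] at h; linarith
  have ha_ct_3 : 0 ≤ 1 - ex μ (a 3) := by
    have h := ex_mono hμ0 (fun t => ha1 3 t); rw [ex_const hμ1] at h; linarith
  have ha_e3h_123 : 0 ≤ 2*ex μ (a 1 * a 2 * a 3) - ex μ (a 1)*ex μ (a 2 * a 3) - ex μ (a 1 * a 2)*ex μ (a 3) - ex μ (a 1 * a 3)*ex μ (a 2) + ex μ (a 1)*ex μ (a 2)*ex μ (a 3) := by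
    have h := hha_e3h_123; rw [sahiE_three] at h; linear_combination h
  have ha_e4h : 0 ≤ 6*ex μ (a 0 * a 1 * a 2 * a 3) - 2*ex μ (a 0)*ex μ (a 1 * a 2 * a 3) - ex μ (a 0 * a 1)*ex μ (a 2 * a 3) - 2*ex μ (a 0 * a 1 * a 2)*ex μ (a 3) - 2*ex μ (a 0 * a 1 * a 3)*ex μ (a 2) - ex μ (a 0 * a 2)*ex μ (a 1 * a 3) - 2*ex μ (a 0 * a 2 * a 3)*ex μ (a 1) - ex μ (a 0 * a 3)*ex μ (a 1 * a 2) + ex μ (a 0)*ex μ (a 1)*ex μ (a 2 * a 3) + ex μ (a 0)*ex μ (a 1 * a 2)*ex μ (a 3) + ex μ (a 0)*ex μ (a 1 * a 3)*ex μ (a 2) + ex μ (a 0 * a 1)*ex μ (a 2)*ex μ (a 3) + ex μ (a 0 * a 2)*ex μ (a 1)*ex μ (a 3) + ex μ (a 0 * a 3)*ex μ (a 1)*ex μ (a 2) - ex μ (a 0)*ex μ (a 1)*ex μ (a 2)*ex μ (a 3) := by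
    have h := hha_e4h; rw [sahiE_four_apply] at h; linear_combination h
  have ha_p3h_01 : 0 ≤ 2*ex μ (a 0 * a 1 * a 2 * a 3) - ex μ (a 0 * a 1)*ex μ (a 2 * a 3) - ex μ (a 0 * a 1 * a 2)*ex μ (a 3) - ex μ (a 0 * a 1 * a 3)*ex μ (a 2) + ex μ (a 0 * a 1)*ex μ (a 2)*ex μ (a 3) := by
    have h := hha_p3h_01; rw [sahiE_three] at h; linear_combination h
  have c02_3 : a 0 * a 2 * a 1 * a 3 = a 0 * a 1 * a 2 * a 3 := by funext t; simp only [Pi.mul_apply]; ring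
  have c02_0 : a 0 * a 2 * a 1 = a 0 * a 1 * a 2 := by funext t; simp only [Pi.mul_apply]; ring
  have ha_p3h_02 : 0 ≤ 2*ex μ (a 0 * a 1 * a 2 * a 3) - ex μ (a 0 * a 1 * a 2)*ex μ (a 3) - ex μ (a 0 * a 2)*ex μ (a 1 * a 3) - ex μ (a 0 * a 2 * a 3)*ex μ (a 1) + ex μ (a 0 * a 2)*ex μ (a 1)*ex μ (a 3) := by
    have h := hha_p3h_02; rw [sahiE_three] at h; rw [c02_3, c02_0] at h; linear_combination h
  have c12_3 : a 1 * a 2 * a 0 * a 3 = a 0 * a 1 * a 2 * a 3 := by funext t; simp only [Pi.mul_apply]; ring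
  have c12_0 : a 1 * a 2 * a 0 = a 0 * a 1 * a 2 := by funext t; simp only [Pi.mul_apply]; ring
  have ha_p3h_12 : 0 ≤ 2*ex μ (a 0 * a 1 * a 2 * a 3) - ex μ (a 0)*ex μ (a 1 * a 2 * a 3) - ex μ (a 0 * a 1 * a 2)*ex μ (a 3) - ex μ (a 0 * a 3)*ex μ (a 1 * a 2) + ex μ (a 0)*ex μ (a 1 * a 2)*ex μ (a 3) := by
    have h := hha_p3h_12; rw [sahiE_three] at h; rw [c12_3, c12_0] at h; linear_combination h
  have c03_3 : a 0 * a 3 * a 1 * a 2 = a 0 * a 1 * a 2 * a 3 := by funext t; simp only [Pi.mul_apply]; ring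
  have c03_0 : a 0 * a 3 * a 1 = a 0 * a 1 * a 3 := by funext t; simp only [Pi.mul_apply]; ring
  have c03_1 : a 0 * a 3 * a 2 = a 0 * a 2 * a 3 := by funext t; simp only [Pi.mul_apply]; ring
  have ha_p3h_03 : 0 ≤ 2*ex μ (a 0 * a 1 * a 2 * a 3) - ex μ (a 0 * a 1 * a 3)*ex μ (a 2) - ex μ (a 0 * a 2 * a 3)*ex μ (a 1) - ex μ (a 0 * a 3)*ex μ (a 1 * a 2) + ex μ (a 0 * a 3)*ex μ (a 1)*ex μ (a 2) := by
    have h := hha_p3h_03; rw [sahiE_three] at h; rw [c03_3, c03_0, c03_1] at h; linear_combination h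
  have ha_t_0 : 0 ≤ ex μ (a 0) := ex_nonneg hμ0 (ha0 0)
  have ha_t_1 : 0 ≤ ex μ (a 1) := ex_nonneg hμ0 (ha0 1)
  have ha_t_2 : 0 ≤ ex μ (a 2) := ex_nonneg hμ0 (ha0 2)
  have ha_t_3 : 0 ≤ ex μ (a 3) := ex_nonneg hμ0 (ha0 3)
  have hb_ct_0 : 0 ≤ 1 - ex ν (b 0) := by
    have h := ex_mono hν0 (fun t => hb1 0 t); rw [ex_const hν1] at h; linarith
  have hb_dt_0_1 : 0 ≤ ex ν (b 0) - ex ν (b 1) := by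
    have h : ex ν (b 0 * b 1) ≤ ex ν (b 0) := ex_mono hν0 (fun t => by
      simp only [Pi.mul_apply]; exact mul_le_of_le_one_right (hb0 0 t) (hb1 1 t))
    rw [hn01] at h; linarith
  have hb_dt_1_2 : 0 ≤ ex ν (b 1) - ex ν (b 2) := by
    have h : ex ν (b 1 * b 2) ≤ ex ν (b 1) := ex_mono hν0 (fun t => by
      simp only [Pi.mul_apply]; exact mul_le_of_le_one_right (hb0 1 t) (hb1 2 t))
    rw [hn12] at h; linarith
  have hb_t_2 : 0 ≤ ex ν (b 2) := ex_nonneg hν0 (hb0 2)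
  rw [sahiE_four_apply, uMoment_0123 μ ν hμ1 hν1 a b, uMoment_012 μ ν hμ1 hν1 a b, uMoment_013 μ ν hμ1 hν1 a b, uMoment_023 μ ν hμ1 hν1 a b, uMoment_123 μ ν hμ1 hν1 a b, uMoment_01 μ ν hμ1 hν1 a b, uMoment_02 μ ν hμ1 hν1 a b, uMoment_03 μ ν hμ1 hν1 a b, uMoment_12 μ ν hμ1 hν1 a b, uMoment_13 μ ν hμ1 hν1 a b, uMoment_23 μ ν hμ1 hν1 a b, uMoment_0 μ ν hμ1 hν1 a b, uMoment_1 μ ν hμ1 hν1 a b, uMoment_2 μ ν hμ1 hν1 a b, uMoment_3 μ ν hμ1 hν1 a b]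
  rw [exFail_0 μ hμ1 a, exFail_1 μ hμ1 a, exFail_2 μ hμ1 a, exFail_3 μ hμ1 a, exFail_01 μ hμ1 a, exFail_02 μ hμ1 a, exFail_03 μ hμ1 a, exFail_12 μ hμ1 a, exFail_13 μ hμ1 a, exFail_23 μ hμ1 a, exFail_012 μ hμ1 a, exFail_013 μ hμ1 a, exFail_023 μ hμ1 a, exFail_123 μ hμ1 a, exFail_0123 μ hμ1 a]
  rw [exFail_0 ν hν1 b, exFail_1 ν hν1 b, exFail_2 ν hν1 b, exFail_3 ν hν1 b, exFail_01 ν hν1 b, exFail_02 ν hν1 b, exFail_03 ν hν1 b, exFail_12 ν hν1 b, exFail_13 ν hν1 b, exFail_23 ν hν1 b, exFail_012 ν hν1 b, exFail_013 ν hν1 b, exFail_023 ν hν1 b, exFail_123 ν hν1 b, exFail_0123 ν hν1 b]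
  rw [zb3, zb03, zb13, zb23, zb013, zb023, zb123, zb0123]
  rw [hn012, hn01, hn02, hn12]
  linear_combination e4_orChain_nonneg_of_holdMoments (ex μ (a 0)) (ex μ (a 1)) (ex μ (a 2)) (ex μ (a 3)) (ex μ (a 0 * a 1)) (ex μ (a 0 * a 2)) (ex μ (a 0 * a 3)) (ex μ (a 1 * a 2)) (ex μ (a 1 * a 3)) (ex μ (a 2 * a 3)) (ex μ (a 0 * a 1 * a 2)) (ex μ (a 0 * a 1 * a 3)) (ex μ (a 0 * a 2 * a 3)) (ex μ (a 1 * a 2 * a 3)) (ex μ (a 0 * a 1 * a 2 * a 3)) (ex ν (b 0)) (ex ν (b 1)) (ex ν (b 2)) ha_at_ ha_at_0 ha_at_13 ha_at_013 ha_at_23 ha_at_023 ha_at_123 ha_at_0123 ha_at_1 ha_at_01 ha_at_2 ha_at_02 ha_at_12 ha_at_012 ha_at_3 ha_at_03 ha_cf_2_3 ha_ch_2_13 ha_ch_2_013 ha_ch_12_3 ha_ch_012_3 ha_ct_0 ha_ct_1 ha_ct_2 ha_ct_3 ha_e3h_123 ha_e4h ha_p3h_01 ha_p3h_02 ha_p3h_12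 ha_p3h_03 ha_t_0 ha_t_1 ha_t_2 ha_t_3 hb_ct_0 hb_dt_0_1 hb_dt_1_2 hb_t_2

end Summit.CriticalPhenomena.PercolationContinuityZ3.Theorems.SahiE4UnionChainBlock
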